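import Summits.CriticalPhenomena.Ising3DConformalLimit.Theorems.IsingEuclidUpgradeIsingEuclidUpgradeR2RotInvPowerLawRigidity
import Summits.CriticalPhenomena.Ising3DConformalLimit.Theorems.IsingEuclidUpgradeIsingEuclidUpgradeR2RotInvPowerLawTowerRays
import HarnessLib

/-!
# Crux `IsingEuclidUpgradeR2RotInvPowerLaw` (stmt-CriticalPhenomena-0634), line `tower_profile_rigidity`:
# the ray dilation law from AXIS DILATIONS × RAY PROFILES, and the glue T1 → S2 → A_rays → r2

Write `G := criticalTwoPoint 3` for the critical two-point function `⟨σ₀σ_x⟩_{β_c}` of the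
nearest-neighbour Ising model on `ℤ³`, `g(n) := G(n e₀)`, `|v|₂ := √(∑ vᵢ²)`.

The landed TOWER × RAYS glue (`IsingEuclidUpgradeR2RotInvPowerLaw_of_towerLaw_of_rayLaw`) reduced the crux
r2 (isotropic pure power law `G(x)|x|₂^{2Δ} → c > 0` cofinitely) to two radial statements: the dyadic
tower law T1 (`g(2^j)(2^j)^{2Δ} → c > 0`) and the ray dilation law Sray
(`G(knv)k^{2Δ}/G(nv) → 1` for every `v ≠ 0`, `k ≥ 1`). This file refines Sray.

**Theorem** (`rayLawAt_of_dilationLawAt_of_rayProfiles`, registered). Fix `Δ`. Assume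
1. (S2 at `Δ`, integer dilation law on the axis) `g(kn)k^{2Δ}/g(n) → 1` for every `k ≥ 1`;
2. (U at `Δ`, uniform dilation law) `g(m_i)(m_i/b_i)^{2Δ}/g(b_i) → 1` whenever `b_i → ∞` and
   eventually `b_i ≤ m_i ≤ 2b_i`;
3. (A_rays, ray profiles) for every `v ≠ 0` the angular ratio `G(nv)/g(⌊n|v|₂⌋)` converges to SOME
   positive constant `c_v` (no continuity in the direction, no isotropy, no relation between rays).
Then Sray holds at `Δ`: `G(knv)k^{2Δ}/G(nv) → 1` for every `v ≠ 0`, `k ≥ 1`.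

Proof. Fix `v ≠ 0`, `k ≥ 1`, and let `c := c_v > 0`, `b_n := ⌊n|v|₂⌋ → ∞`, `m_n := b_{kn} = ⌊kn|v|₂⌋`.
Hypothesis 3 gives `G(nv)/g(b_n) → c`, and ALONG THE SUBSEQUENCE `n ↦ kn` of the same ray (same
constant!) `G(knv)/g(m_n) → c`. The floor sandwich `k b_n ≤ m_n < k b_n + k` holds; hypothesis 1 along
`b_n` gives `g(k b_n)k^{2Δ}/g(b_n) → 1`; hypothesis 2 with base `k b_n`, `m := m_n` and
`(m_n/(k b_n))^{2Δ} → 1` gives `g(m_n)/g(k b_n) → 1`. Multiplying the four ratios,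
`G(knv)k^{2Δ}/G(nv) = [G(knv)/g(m_n)]·[g(m_n)/g(k b_n)]·[g(k b_n)k^{2Δ}/g(b_n)]·[g(b_n)/G(nv)]
 → c·1·1·c⁻¹ = 1`. (This is the proof of the landed `rayDilationLaw_of_axisLaw_of_profile` with the
profile value `Ψ(v̂)` replaced by the ray constant `c_v`.)

**Corollary** (`IsingEuclidUpgradeR2RotInvPowerLaw_of_towerLaw_of_dilationLaw_of_rayProfiles`,
registered glue TOWER × AXIS-DILATIONS × RAY-PROFILES). `T1 → (∃ Δ, S2 at Δ) → A_rays → r2`: U at `Δ` is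
the landed transfer `stub_uniformDilationTransfer`, the theorem gives Sray at `Δ`, and the landed
TOWER × RAYS glue concludes. Conversely r2 implies each of T1, S2, A_rays (with `c_v = 1`), whence the
split is lossless: `r2 ↔ T1 ∧ (∃ Δ, S2 at Δ) ∧ A_rays`
(`rotInvPowerLaw_iff_towerLaw_and_dilationLaw_and_rayProfiles`).

References: H. Duminil-Copin, ICM 2022, §8.1 (rotation invariance of the critical two-point function on
`ℤ³` is postulated, not proved) [DuminilCopinICM2022]. No definitions are introduced.
-/

noncomputable section

namespace Summit.CriticalPhenomena.Ising3DConformalLimit.Cruxes.IsingEuclidUpgradeR2RotInvPowerLaw.TowerProfileRigidity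

open Filter Topology Literature.Probability.LatticeModels
open Summit.CriticalPhenomena.Ising3DConformalLimit.Theorems.IsingEuclidUpgradeR2Split
  (ratioIsotropy_of_rotInvPowerLaw)

/-! ### S2 ∧ U ∧ (one ray profile) ⇒ the dilation law along that ray -/

/-- **The ray dilation law from the axis dilation laws and a ray profile constant.** If the axis
sequence `g` obeys the integer dilation law `g(kn)k^{2Δ}/g(n) → 1` and its uniform version on windows
`[b, 2b]`, and along the ray `ℤv`, `v ≠ 0`, the angular ratio `G(nv)/g(⌊n|v|₂⌋)` converges to some
`c > 0`, then `G(knv)k^{2Δ}/G(nv) → 1` for every `k ≥ 1`. [cite: DuminilCopinICM2022, §8.1] -/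
theorem rayDilationLaw_of_axisLaw_of_rayProfile {Δ : ℝ}
    (hS : ∀ k : ℕ, 1 ≤ k → Tendsto (fun n : ℕ => criticalTwoPoint 3 (Pi.single 0 ((k * n : ℕ) : ℤ)) *
      (k : ℝ) ^ (2 * Δ) / criticalTwoPoint 3 (Pi.single 0 ((n : ℕ) : ℤ))) atTop (𝓝 1))
    (hU : ∀ b m : ℕ → ℕ, Tendsto b atTop atTop → (∀ᶠ i in atTop, b i ≤ m i ∧ m i ≤ 2 * b i) →
      Tendsto (fun i : ℕ => criticalTwoPoint 3 (Pi.single 0 ((m i : ℕ) : ℤ)) *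
        ((m i : ℝ) / (b i : ℝ)) ^ (2 * Δ) / criticalTwoPoint 3 (Pi.single 0 ((b i : ℕ) : ℤ)))
        atTop (𝓝 1))
    (v : Site 3) (hv : v ≠ 0) {c : ℝ} (hc : 0 < c)
    (hconv : Tendsto (fun n : ℕ => criticalTwoPoint 3 (((n : ℕ) : ℤ) • v) /
      criticalTwoPoint 3 (Pi.single 0 ((⌊(n : ℝ) * Real.sqrt (∑ i, ((v i : ℝ)) ^ 2)⌋₊ : ℕ) : ℤ)))
      atTop (𝓝 c))
    (k : ℕ) (hk : 1 ≤ k) :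
    Tendsto (fun n : ℕ => criticalTwoPoint 3 (((k * n : ℕ) : ℤ) • v) * (k : ℝ) ^ (2 * Δ) /
      criticalTwoPoint 3 (((n : ℕ) : ℤ) • v)) atTop (𝓝 1) := by
  -- notation
  set L : ℝ := Real.sqrt (∑ i, ((v i : ℝ)) ^ 2)
  set g : ℕ → ℝ := fun n => criticalTwoPoint 3 (Pi.single 0 ((n : ℕ) : ℤ))
  -- positivity of the two-point function
  have hGpos : ∀ x : Site 3, 0 < criticalTwoPoint 3 x := by
    intro x
    by_cases hx : x = 0
    · rw [hx, criticalTwoPoint_zero']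
      exact one_pos
    · obtain ⟨c₀, C, hc₀, hbd⟩ := criticalTwoPoint_bounds_holds (d := 3) (by norm_num)
      exact lt_of_lt_of_le (mul_pos hc₀ (Real.rpow_pos_of_pos (norm_pos_iff.2 hx) _)) (hbd _ hx).1
  have hgpos : ∀ n : ℕ, 0 < g n := fun n => criticalTwoPoint_axis_pos n
  have hk0 : (0 : ℝ) < k := by exact_mod_cast hk
  have hLpos : 0 < L := sqrt_sum_sq_pos_of_ne_zero v hv
  -- the integer scale `b_n := ⌊n|v|₂⌋`; the dilated scale is `m_n := b_{kn} = ⌊kn|v|₂⌋`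
  set b : ℕ → ℕ := fun n => ⌊(n : ℝ) * L⌋₊
  have hkn : Tendsto (fun n : ℕ => k * n) atTop atTop :=
    tendsto_atTop_mono (fun n => Nat.le_mul_of_pos_left n hk) tendsto_id
  -- step 1: the profile along the ray, `G(nv)/g(b_n) → c`, and along its `k`-dilate, SAME constant
  have h2 : Tendsto (fun n : ℕ => criticalTwoPoint 3 (((n : ℕ) : ℤ) • v) / g (b n)) atTop (𝓝 c) :=
    hconv
  have h2k : Tendsto (fun n : ℕ => criticalTwoPoint 3 (((k * n : ℕ) : ℤ) • v) / g (b (k * n))) atTop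
      (𝓝 c) := h2.comp hkn
  -- step 2: `b_n → ∞` and the sandwich `k b_n ≤ b_{kn} < k b_n + k`
  have hb_top : Tendsto b atTop atTop :=
    tendsto_nat_floor_atTop.comp (tendsto_natCast_atTop_atTop.atTop_mul_const hLpos)
  have hkb_top : Tendsto (fun n => k * b n) atTop atTop := hkn.comp hb_top
  have hkb : ∀ n, k * b n ≤ b (k * n) := by
    intro n
    show k * ⌊(n : ℝ) * L⌋₊ ≤ ⌊((k * n : ℕ) : ℝ) * L⌋₊
    rw [Nat.cast_mul, mul_assoc]
    exact mul_nat_floor_le_floor_mul k (mul_nonneg (Nat.cast_nonneg n) hLpos.le)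
  have hmk : ∀ n, b (k * n) < k * b n + k := by
    intro n
    show ⌊((k * n : ℕ) : ℝ) * L⌋₊ < k * ⌊(n : ℝ) * L⌋₊ + k
    rw [Nat.cast_mul, mul_assoc]
    exact floor_mul_lt_mul_nat_floor_add hk (mul_nonneg (Nat.cast_nonneg n) hLpos.le)
  have hb1 : ∀ᶠ n in atTop, 1 ≤ b n := hb_top.eventually (eventually_ge_atTop 1)
  have hsand : ∀ᶠ n in atTop, k * b n ≤ b (k * n) ∧ b (k * n) ≤ 2 * (k * b n) := by
    filter_upwards [hb1] with n hn
    refine ⟨hkb n, ?_⟩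
    have h1 := hmk n
    have h2 : k ≤ k * b n := Nat.le_mul_of_pos_right k hn
    omega
  -- step 3: hypothesis S2 along `b_n`
  have h3 : Tendsto (fun n => g (k * b n) * (k : ℝ) ^ (2 * Δ) / g (b n)) atTop (𝓝 1) :=
    (hS k hk).comp hb_top
  -- step 4: hypothesis U with base `k b_n` and `m := b_{kn}`, and `b_{kn}/(k b_n) → 1`
  have h5 : Tendsto (fun n => g (b (k * n)) * (((b (k * n) : ℕ) : ℝ) / ((k * b n : ℕ) : ℝ)) ^ (2 * Δ) /
      g (k * b n)) atTop (𝓝 1) := hU (fun n => k * b n) (fun n => b (k * n)) hkb_top hsand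
  have hratio : Tendsto (fun n => ((b (k * n) : ℕ) : ℝ) / ((k * b n : ℕ) : ℝ)) atTop (𝓝 1) := by
    have hup : Tendsto (fun n => (1 : ℝ) + 1 / ((b n : ℕ) : ℝ)) atTop (𝓝 1) := by
      have h := (tendsto_one_div_atTop_nhds_zero_nat.comp hb_top).const_add (1 : ℝ)
      rw [add_zero] at h
      exact h
    refine tendsto_of_tendsto_of_tendsto_of_le_of_le' tendsto_const_nhds hup ?_ ?_
    · filter_upwards [hb1] with n hn
      have hkb0 : (0 : ℝ) < ((k * b n : ℕ) : ℝ) := by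
        have : 1 ≤ k * b n := Nat.le_mul_of_pos_right k hn |>.trans' hk
        exact_mod_cast this
      rw [le_div_iff₀ hkb0, one_mul]
      exact_mod_cast hkb n
    · filter_upwards [hb1] with n hn
      have hb0 : (0 : ℝ) < ((b n : ℕ) : ℝ) := by exact_mod_cast hn
      have hkb0 : (0 : ℝ) < ((k * b n : ℕ) : ℝ) := by push_cast; positivity
      rw [div_le_iff₀ hkb0]
      have h1 : ((b (k * n) : ℕ) : ℝ) < (k : ℝ) * ((b n : ℕ) : ℝ) + k := by exact_mod_cast hmk n
      have h2 : (1 + 1 / ((b n : ℕ) : ℝ)) * ((k * b n : ℕ) : ℝ) = (k : ℝ) * ((b n : ℕ) : ℝ) + k := by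
        push_cast
        field_simp
      rw [h2]
      exact h1.le
  have h6 : Tendsto (fun n => (((b (k * n) : ℕ) : ℝ) / ((k * b n : ℕ) : ℝ)) ^ (2 * Δ)) atTop (𝓝 1) := by
    have h := hratio.rpow_const (p := 2 * Δ) (Or.inl one_ne_zero)
    rwa [Real.one_rpow] at h
  have h7 : Tendsto (fun n => g (b (k * n)) / g (k * b n)) atTop (𝓝 1) := by
    have h := h5.div h6 one_ne_zero
    rw [div_one] at h
    refine h.congr' ?_
    filter_upwards [hb1] with n hn
    have hb0 : (0 : ℝ) < ((b n : ℕ) : ℝ) := by exact_mod_cast hn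
    have hkb0 : (0 : ℝ) < ((k * b n : ℕ) : ℝ) := by push_cast; positivity
    have hm0 : (0 : ℝ) < ((b (k * n) : ℕ) : ℝ) := by
      have : 1 ≤ b (k * n) := (hkb n).trans' (Nat.le_mul_of_pos_right k hn |>.trans' hk)
      exact_mod_cast this
    have hr : (0 : ℝ) < (((b (k * n) : ℕ) : ℝ) / ((k * b n : ℕ) : ℝ)) ^ (2 * Δ) :=
      Real.rpow_pos_of_pos (div_pos hm0 hkb0) _
    have hg1 := (hgpos (k * b n)).ne'
    simp only [Pi.div_apply]
    field_simp
  -- step 5: the reciprocal profile limit `g(b_n)/G(nv) → c⁻¹`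
  have h8 : Tendsto (fun n : ℕ => g (b n) / criticalTwoPoint 3 (((n : ℕ) : ℤ) • v)) atTop
      (𝓝 c⁻¹) := by
    have h := h2.inv₀ hc.ne'
    refine h.congr fun n => ?_
    rw [inv_div]
  -- assemble the four ratios
  have hprod := ((h2k.mul h7).mul h3).mul h8
  have hlim : c * 1 * 1 * c⁻¹ = 1 := by
    rw [mul_one, mul_one, mul_inv_cancel₀ hc.ne']
  rw [hlim] at hprod
  refine hprod.congr fun n => ?_
  have hg1 := (hgpos (b (k * n))).ne'
  have hg2 := (hgpos (k * b n)).ne'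
  have hg3 := (hgpos (b n)).ne'
  have hG := (hGpos (((n : ℕ) : ℤ) • v)).ne'
  field_simp

/-- **AXIS-DILATIONS × RAY-PROFILES ⇒ RAYS (registered name `rayLawAt_of_dilationLawAt_of_rayProfiles`,
verbatim).** For every exponent `Δ`: the integer dilation law S2 of the critical axis two-point sequence
at `Δ`, its uniform version U on windows `[b, 2b]`, and the mere existence, ray by ray, of a positive
limit `c_v` of the angular ratio `⟨σ₀σ_{nv}⟩_{β_c}/⟨σ₀σ_{⌊n|v|₂⌋e₀}⟩_{β_c}` (A_rays) together give the
ray dilation law `⟨σ₀σ_{knv}⟩_{β_c}k^{2Δ}/⟨σ₀σ_{nv}⟩_{β_c} → 1` along every lattice ray at the same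
`Δ` (Sray at `Δ`). Pointwise in `v` by `rayDilationLaw_of_axisLaw_of_rayProfile`.
[cite: DuminilCopinICM2022, §8.1] -/
theorem rayLawAt_of_dilationLawAt_of_rayProfiles : ∀ Δ : ℝ, (∀ k : ℕ, 1 ≤ k → Filter.Tendsto (fun n : ℕ => Literature.Probability.LatticeModels.criticalTwoPoint 3 (Pi.single 0 ((k * n : ℕ) : ℤ)) * (k : ℝ) ^ (2 * Δ) / Literature.Probability.LatticeModels.criticalTwoPoint 3 (Pi.single 0 ((n : ℕ) : ℤ))) Filter.atTop (nhds 1)) → (∀ b m : ℕ → ℕ, Filter.Tendsto b Filter.atTop Filter.atTop → (∀ᶠ i in Filter.atTop, b i ≤ m i ∧ m i ≤ 2 * b i) → Filter.Tendsto (fun i : ℕ => Literature.Probability.LatticeModels.criticalTwoPoint 3 (Pi.single 0 ((m i : ℕ) : ℤ)) * ((m i : ℝ) / (b i : ℝ)) ^ (2 * Δ) / Literature.Probability.LatticeModels.criticalTwoPoint 3 (Pi.single 0 ((b i : ℕ) : ℤ))) Filter.atTop (nhds 1)) → (∀ v : Literature.Probability.LatticeModels.Site 3, v ≠ 0 → ∃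 c : ℝ, 0 < c ∧ Filter.Tendsto (fun n : ℕ => Literature.Probability.LatticeModels.criticalTwoPoint 3 (((n : ℕ) : ℤ) • v) / Literature.Probability.LatticeModels.criticalTwoPoint 3 (Pi.single 0 ((⌊(n : ℝ) * Real.sqrt (∑ i, ((v i : ℝ)) ^ 2)⌋₊ : ℕ) : ℤ))) Filter.atTop (nhds c)) → ∀ v : Literature.Probability.LatticeModels.Site 3, v ≠ 0 → ∀ k : ℕ, 1 ≤ k → Filter.Tendsto (fun n : ℕ => Literature.Probability.LatticeModels.criticalTwoPoint 3 (((k * n : ℕ) : ℤ) • v) * (k : ℝ) ^ (2 * Δ) / Literature.Probability.LatticeModels.criticalTwoPoint 3 (((n : ℕ) : ℤ) • v)) Filter.atTop (nhds 1) := by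
  intro Δ hS hU hA v hv k hk
  obtain ⟨c, hc, hconv⟩ := hA v hv
  exact rayDilationLaw_of_axisLaw_of_rayProfile hS hU v hv hc hconv k hk

/-! ### The glue T1 → S2 → A_rays → r2 (registered name) -/

/-- **TOWER × AXIS-DILATIONS × RAY-PROFILES glue (registered name
`IsingEuclidUpgradeR2RotInvPowerLaw_of_towerLaw_of_dilationLaw_of_rayProfiles`, verbatim): T1 → S2 → A_rays → r2.**
From S2 at `Δ`: U at `Δ` by the landed transfer `stub_uniformDilationTransfer`; with A_rays, Sray at `Δ`
by `rayLawAt_of_dilationLawAt_of_rayProfiles`; with T1, the landed TOWER × RAYS glue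
`IsingEuclidUpgradeR2RotInvPowerLaw_of_towerLaw_of_rayLaw` concludes the route decl by name.
[cite: DuminilCopinICM2022, §8.1] -/
theorem IsingEuclidUpgradeR2RotInvPowerLaw_of_towerLaw_of_dilationLaw_of_rayProfiles : (∃ Δ c : ℝ, 0 < c ∧ Filter.Tendsto (fun j : ℕ => Literature.Probability.LatticeModels.criticalTwoPoint 3 (Pi.single 0 ((2 ^ j : ℕ) : ℤ)) * ((2 ^ j : ℕ) : ℝ) ^ (2 * Δ)) Filter.atTop (nhds c)) → (∃ Δ : ℝ, ∀ k : ℕ, 1 ≤ k → Filter.Tendsto (fun n : ℕ => Literature.Probability.LatticeModels.criticalTwoPoint 3 (Pi.single 0 ((k * n : ℕ) : ℤ)) * (k : ℝ) ^ (2 * Δ) / Literature.Probability.LatticeModels.criticalTwoPoint 3 (Pi.single 0 ((n : ℕ) : ℤ))) Filter.atTop (nhds 1)) → (∀ v : Literature.Probability.LatticeModels.Site 3, v ≠ 0 → ∃ c : ℝ, 0 < c ∧ Filter.Tendsto (fun n : ℕ => Literature.Probability.LatticeModels.criticalTwoPoint 3 (((n : ℕ) : ℤ) • v) / Literature.Probability.LatticeModels.criticalTwoPoint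 3 (Pi.single 0 ((⌊(n : ℝ) * Real.sqrt (∑ i, ((v i : ℝ)) ^ 2)⌋₊ : ℕ) : ℤ))) Filter.atTop (nhds c)) → Summit.CriticalPhenomena.Ising3DConformalLimit.Theses.IsingEuclidUpgrade.IsingEuclidUpgradeR2RotInvPowerLaw := by
  intro hT hS2 hA
  obtain ⟨Δ, hdil⟩ := hS2
  exact IsingEuclidUpgradeR2RotInvPowerLaw_of_towerLaw_of_rayLaw hT
    ⟨Δ, rayLawAt_of_dilationLawAt_of_rayProfiles Δ hdil (stub_uniformDilationTransfer Δ hdil) hA⟩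

/-! ### Converses: the three-way split is lossless -/

/-- **r2 ⇒ S2**: the ray law given by r2 (landed `rayLaw_of_rotInvPowerLaw`), restricted to the axis
(`dilationLawAt_of_rayLawAt`). [folklore] -/
theorem dilationLaw_of_rotInvPowerLaw
    (h : Summit.CriticalPhenomena.Ising3DConformalLimit.Theses.IsingEuclidUpgrade.IsingEuclidUpgradeR2RotInvPowerLaw) :
    ∃ Δ : ℝ, ∀ k : ℕ, 1 ≤ k → Filter.Tendsto (fun n : ℕ => Literature.Probability.LatticeModels.criticalTwoPoint 3 (Pi.single 0 ((k * n : ℕ) : ℤ)) * (k : ℝ) ^ (2 * Δ) / Literature.Probability.LatticeModels.criticalTwoPoint 3 (Pi.single 0 ((n : ℕ) : ℤ))) Filter.atTop (nhds 1) := by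
  obtain ⟨Δ, hr⟩ := rayLaw_of_rotInvPowerLaw h
  exact ⟨Δ, dilationLawAt_of_rayLawAt hr⟩

/-- **r2 ⇒ A_rays** with every ray constant `c_v = 1`: ratio isotropy (landed
`ratioIsotropy_of_rotInvPowerLaw`) pulled back along the injective ray `n ↦ nv`, where
`⌊|nv|₂⌋ = ⌊n|v|₂⌋`. [folklore] -/
theorem rayProfiles_of_rotInvPowerLaw
    (h : Summit.CriticalPhenomena.Ising3DConformalLimit.Theses.IsingEuclidUpgrade.IsingEuclidUpgradeR2RotInvPowerLaw) :
    ∀ v : Literature.Probability.LatticeModels.Site 3, v ≠ 0 → ∃ c : ℝ, 0 < c ∧ Filter.Tendsto (fun n : ℕ => Literature.Probability.LatticeModels.criticalTwoPoint 3 (((n : ℕ) : ℤ) • v) / Literature.Probability.LatticeModels.criticalTwoPoint 3 (Pi.single 0 ((⌊(n : ℝ) * Real.sqrt (∑ i, ((v i : ℝ)) ^ 2)⌋₊ : ℕ) : ℤ))) Filter.atTop (nhds c) := by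
  intro v hv
  refine ⟨1, one_pos, ?_⟩
  refine ((ratioIsotropy_of_rotInvPowerLaw h).comp (tendsto_natSmul_cofinite v hv)).congr fun n => ?_
  simp only [Function.comp_apply]
  rw [sqrt_sum_sq_natSmul]

/-- **The crux is EQUIVALENT to TOWER ∧ AXIS-DILATIONS ∧ RAY-PROFILES:**
`r2 ↔ T1 ∧ (∃ Δ, S2 at Δ) ∧ A_rays`. Refuting any of the three radial/angular children refutes the crux;
proving all three proves it. [cite: DuminilCopinICM2022, §8.1] -/
theorem rotInvPowerLaw_iff_towerLaw_and_dilationLaw_and_rayProfiles :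
    Summit.CriticalPhenomena.Ising3DConformalLimit.Theses.IsingEuclidUpgrade.IsingEuclidUpgradeR2RotInvPowerLaw ↔
      ((∃ Δ c : ℝ, 0 < c ∧ Filter.Tendsto (fun j : ℕ => Literature.Probability.LatticeModels.criticalTwoPoint 3 (Pi.single 0 ((2 ^ j : ℕ) : ℤ)) * ((2 ^ j : ℕ) : ℝ) ^ (2 * Δ)) Filter.atTop (nhds c)) ∧
        (∃ Δ : ℝ, ∀ k : ℕ, 1 ≤ k → Filter.Tendsto (fun n : ℕ => Literature.Probability.LatticeModels.criticalTwoPoint 3 (Pi.single 0 ((k * n : ℕ) : ℤ)) * (k : ℝ) ^ (2 * Δ) / Literature.Probability.LatticeModels.criticalTwoPoint 3 (Pi.single 0 ((n : ℕ) : ℤ))) Filter.atTop (nhds 1)) ∧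
        (∀ v : Literature.Probability.LatticeModels.Site 3, v ≠ 0 → ∃ c : ℝ, 0 < c ∧ Filter.Tendsto (fun n : ℕ => Literature.Probability.LatticeModels.criticalTwoPoint 3 (((n : ℕ) : ℤ) • v) / Literature.Probability.LatticeModels.criticalTwoPoint 3 (Pi.single 0 ((⌊(n : ℝ) * Real.sqrt (∑ i, ((v i : ℝ)) ^ 2)⌋₊ : ℕ) : ℤ))) Filter.atTop (nhds c))) :=
  ⟨fun h => ⟨towerLaw_of_rotInvPowerLaw h, dilationLaw_of_rotInvPowerLaw h, rayProfiles_of_rotInvPowerLaw h⟩,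
    fun h => IsingEuclidUpgradeR2RotInvPowerLaw_of_towerLaw_of_dilationLaw_of_rayProfiles h.1 h.2.1 h.2.2⟩

end Summit.CriticalPhenomena.Ising3DConformalLimit.Cruxes.IsingEuclidUpgradeR2RotInvPowerLaw.TowerProfileRigidity

end
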